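/-
Copyright (c) 2026 the pub-hodgecm-mathlib formalisation cell (harness21).  Prover seat hodgecm-mathlib-K2E5-p17 (g7), Track B «K2-LIT»,
#184♮ = hLiu418 = `stmt-HodgeConjecture-24832`; ROAD Φ, G5-b = Φ7-3 (LEAD F0P6-plan (g14) BATCH #28 (2) 2026-09-04T14:09:56Z), FILE 1 (γ′) = THE PACKAGING of the
RANK-ONE Fourier coefficients, census `K2/K2E5-p17/g7/CENSUS-G5b-RankOneTermPackage.K2E5-p17-g7.md` 4a4be154eb368c66.  THEOREMS ONLY (no `def`, no `instance`, no
named-fact hypothesis, no `sorry`); hypothesis-first ((R1-α) unfolding, (R1-β) Godement form, (R1-γ) inner Whittaker continuation + growth BY VALUE).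
-/
import Summits.HodgeConjecture.HodgeConjecture.Theorems.K2LiuContinuityFromHalfPlane
import Mathlib.Analysis.SpecialFunctions.Pow.Real
import HarnessLib

/-!
# Crux `HLiu418`, ROAD Φ, organ Φ7-3 (γ′): THE RANK-ONE FOURIER COEFFICIENT AS A (P,E⋆)-TERM PACKAGE WITH `P = {½}` — from its expression as a finite sum
# `Σ_j a_j(s,x)·(W⁽ᵇ⁾_j(s,x) + W⁽ᵃ⁾_j(s,x))` of INNER-LINE WHITTAKER VALUES of the Godement constituents of the inner section

Cell `hodgecm-mathlib`, crux item hLiu418 = `stmt-HodgeConjecture-24832` (helper lane, count-neutral).  THE SETTING (census §0; [KudlaRallis1994, §2], [Shimura1997, §18],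
[MoeglinWaldspurger1995, II.1.7]): at `n = 2` a rank-one index `S = u ⊗ w` has a corner-supported rational conjugate `S^{p′} = μ·E₁₁` (★ Φ7-1 (i)); the identity cell of the
`S`-th coefficient dies (★ Φ2) and `E^Δ_S = W_S + MID_S = W⁽¹⁾_μ(M_{X₁₂}F_s) + c_β·W⁽¹⁾_μ(CT_{X₁₂}F_s)` — the inner-line (`n = 1`) Whittaker functional `W⁽¹⁾_μ` applied to the two
constant terms of the `GL₂` Borel series of the INNER SECTION `F_s = M_{χ₂}(s)f_s` (the object of G5-a).  With `F_s = Σ_j c_j(s)·φ_{j,s}` in Godement form (G5-a (β)) this is a FINITE SUM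
  `RK(s, x) = Σ_j a_j(s, x) · (W⁽ᵇ⁾_j(s, x) + W⁽ᵃ⁾_j(s, x))`,
`W⁽ᵇ⁾_j` = the middle-cell inner Whittaker value at parameter `s + ½` (HOLOMORPHIC on `{0 < re}`), `W⁽ᵃ⁾_j` = the big-cell one at parameter `s − ½` carrying the Tate ratio
`Λ(2s)∕Λ(2s+1)` — its only pole on `{0 < re}` is `s = ½`, so `(s − ½)·W⁽ᵃ⁾_j` is HOLOMORPHIC there (census R-1: the letters are COMPUTED in (R1-α)∕(R1-γ), here BY VALUE).
THIS FILE (abstract `X` in place of `H(𝔸)`, any height `X → ℝ_{>0}`, the ★ `K2LiuSiegelEisensteinRankZeroTermPackage.exists_middle_package` shape token for token) turns such a sum into a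
TERM PACKAGE in the currency of ★ Φ9 `K2LiuSiegelEisensteinAssembly`:  `E₇′(s, x) := Σ_j a_j(s, x) · ((s − ½)·(W⁽ᵇ⁾_j + W⁽ᵃ⁾_j)(s, x))`, so that (iv) `E₇′ = (s − ½)·RK` on the
convergence half-plane `{c < re}`, (i) `E₇′(·, x)` is HOLOMORPHIC on `{0 < re}`, (v) GROWTH `‖E₇′(s,x)‖ ≤ C‖x‖^A` locally uniformly in `s` from the by-value growth of the `a_j` and of
the pole-cleared inner values (ONE letter `hWg` for `(s − ½)·(W⁽ᵇ⁾_j + W⁽ᵃ⁾_j)`; two monomial bounds merge at `X = H(𝔸)` by ★ `K2LiuContinuationPackageAlgebra`'s height floor), and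
(ii) CONTINUITY of `E₇′(s, ·)` for EVERY `0 < re s` by ★ `K2LiuContinuityFromHalfPlane.continuous_of_differentiableOn_halfPlane` (Vitali) from (i), (v) and the continuity of
`RK(s, ·)` on the convergence half-plane — no continuity of the (non-canonical) coordinates `a_j(s, ·)`, `W_j(s, ·)` is needed.
HEAD: **`exists_rankOne_package`** `: ∃ E₇′, (i) ∧ (ii) ∧ (iv with P = {½}) ∧ (v)`.  Also `differentiableOn_halfShift_mul_add` (the pole-cleared sum is holomorphic).
Sources: [MoeglinWaldspurger1995, II.1.7, IV.1.9]; [KudlaRallis1994, §2]; [Shimura1997, §18.3–18.5]; [Tan1999, §4 Prop. 4.8].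
HONEST LABEL.  Helper lemmas, count-neutral; `HC_CM` is proved only modulo the 7 printed citations (2 remaining named inputs:
hLiu418 = `stmt-HodgeConjecture-24832`, h413 = `stmt-HodgeConjecture-24833`) until rung 0 closes.
-/

set_option autoImplicit false
set_option linter.dupNamespace false -- the mandated namespace repeats `HodgeConjecture.HodgeConjecture`

noncomputable section

namespace Summit.HodgeConjecture.HodgeConjecture.Cruxes.HLiu418.K2LiuSiegelEisensteinRankOneTermPackage

open Set Filter Topology Metric Complex
open scoped BigOperators
open K2LiuContinuityFromHalfPlane

variable {X : Type*} [TopologicalSpace X] [FirstCountableTopology X] {ι : Type*} [Fintype ι]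

/-! ## 1. The pole-cleared inner values are holomorphic -/

omit [TopologicalSpace X] [FirstCountableTopology X] [Fintype ι] in
/-- `s ↦ (s − ½)·(W⁽ᵇ⁾(s) + W⁽ᵃ⁾(s))` is holomorphic on `{0 < re}` when `W⁽ᵇ⁾` and `(s − ½)·W⁽ᵃ⁾` are. [cite: MoeglinWaldspurger1995, IV.1.9] -/
theorem differentiableOn_halfShift_mul_add (Wb Wa : ι → ℂ → X → ℂ)
    (hWb : ∀ j x, DifferentiableOn ℂ (fun s => Wb j s x) {s : ℂ | 0 < s.re})
    (hWa : ∀ j x, DifferentiableOn ℂ (fun s => (s - 1 / 2) * Wa j s x) {s : ℂ | 0 < s.re}) (j : ι) (x : X) :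
    DifferentiableOn ℂ (fun s => (s - 1 / 2) * (Wb j s x + Wa j s x)) {s : ℂ | 0 < s.re} := by
  have h : DifferentiableOn ℂ (fun s => (s - 1 / 2) * Wb j s x + (s - 1 / 2) * Wa j s x) {s : ℂ | 0 < s.re} :=
    ((differentiableOn_id.sub_const _).mul (hWb j x)).add (hWa j x)
  exact h.congr fun s _ => mul_add _ _ _

/-! ## 2. The rank-one package -/

/-- **Φ7-3 (γ′): THE RANK-ONE COEFFICIENT AS A TERM PACKAGE WITH `P = {½}`.**  DATA (by value): a height `height : X → ℝ` (positive, bounded on compacts); a finite family of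
coefficients `a j : ℂ → X → ℂ` holomorphic on `{0 < re}` in `s` with `‖a j s x‖ ≤ C_a·height x^{A_a}` near every `z` (`0 < re z`); INNER-LINE WHITTAKER VALUES `Wb j` (middle cell,
parameter `s + ½`: holomorphic on `{0 < re}`) and `Wa j` (big cell, parameter `s − ½`: `(s − ½)·Wa j` holomorphic on `{0 < re}`) with the pole-cleared growth
`‖(s − ½)·(Wb j s x + Wa j s x)‖ ≤ C_W·height x^{A_W}` near every `z`; and `RK : ℂ → X → ℂ` continuous in `x` and EQUAL to `Σ_j a j s x · (Wb j s x + Wa j s x)` for `c < re s`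
(`0 ≤ c`; organs (R1-α)(R1-β)).  THEN there is `E₇′ : ℂ → X → ℂ` with (i) `s ↦ E₇′ s x` holomorphic on `{0 < re}`, (ii) `E₇′ s` continuous for `0 < re s`, (iv)
`E₇′ s x = (s − ½)·RK s x` for `c < re s`, (v) `‖E₇′ s x‖ ≤ C·height x^A` locally uniformly in `s` — the (P,E⋆)-package of the rank-one coefficient, `P = {½}`.
[cite: MoeglinWaldspurger1995, II.1.7, IV.1.9] [cite: KudlaRallis1994, §2] [cite: Shimura1997, §18.3] [cite: Tan1999, §4 Prop. 4.8] -/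
theorem exists_rankOne_package
    (height : X → ℝ) (hpos : ∀ x, 0 < height x) (hcpt : ∀ K : Set X, IsCompact K → ∃ B : ℝ, ∀ x ∈ K, height x ≤ B)
    (a : ι → ℂ → X → ℂ) (had : ∀ j x, DifferentiableOn ℂ (fun s => a j s x) {s : ℂ | 0 < s.re})
    (hag : ∀ z : ℂ, 0 < z.re → ∃ C A r : ℝ, 0 ≤ C ∧ 0 ≤ A ∧ 0 < r ∧ ∀ s : ℂ, dist s z < r → ∀ j x, ‖a j s x‖ ≤ C * height x ^ A)
    (Wb Wa : ι → ℂ → X → ℂ)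
    (hWb : ∀ j x, DifferentiableOn ℂ (fun s => Wb j s x) {s : ℂ | 0 < s.re})
    (hWa : ∀ j x, DifferentiableOn ℂ (fun s => (s - 1 / 2) * Wa j s x) {s : ℂ | 0 < s.re})
    (hWg : ∀ z : ℂ, 0 < z.re → ∃ C A r : ℝ, 0 ≤ C ∧ 0 ≤ A ∧ 0 < r ∧ ∀ s : ℂ, dist s z < r →
      ∀ j x, ‖(s - 1 / 2) * (Wb j s x + Wa j s x)‖ ≤ C * height x ^ A)
    {c : ℝ} (hc : 0 ≤ c) (RK : ℂ → X → ℂ) (hRKc : ∀ s : ℂ, c < s.re → Continuous (RK s))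
    (hRK : ∀ (s : ℂ) (x : X), c < s.re → RK s x = ∑ j, a j s x * (Wb j s x + Wa j s x)) :
    ∃ E₇ : ℂ → X → ℂ,
      (∀ x, DifferentiableOn ℂ (fun s => E₇ s x) {s : ℂ | 0 < s.re}) ∧
      (∀ s : ℂ, 0 < s.re → Continuous (E₇ s)) ∧
      (∀ (s : ℂ) (x : X), c < s.re → E₇ s x = (∏ p ∈ ({1 / 2} : Finset ℂ), (s - p)) * RK s x) ∧
      (∀ z : ℂ, 0 < z.re → ∃ C A r : ℝ, 0 < r ∧ ∀ s : ℂ, dist s z < r → ∀ x, ‖E₇ s x‖ ≤ C * height x ^ A) := by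
  -- the package
  set E₇ : ℂ → X → ℂ := fun s x => ∑ j, a j s x * ((s - 1 / 2) * (Wb j s x + Wa j s x)) with hE₇
  -- (i) holomorphy on `{0 < re}`
  have hd : ∀ x, DifferentiableOn ℂ (fun s => E₇ s x) {s : ℂ | 0 < s.re} := by
    intro x
    exact DifferentiableOn.fun_sum fun j _ => (had j x).mul (differentiableOn_halfShift_mul_add Wb Wa hWb hWa j x)
  -- (iv) agreement on `c < re s`
  have heq : ∀ (s : ℂ) (x : X), c < s.re → E₇ s x = (∏ p ∈ ({1 / 2} : Finset ℂ), (s - p)) * RK s x := by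
    intro s x hs
    rw [Finset.prod_singleton, hRK s x hs, Finset.mul_sum]
    exact Finset.sum_congr rfl fun j _ => by ring
  -- (v) growth (with signs recorded, for the compact bound of (ii))
  have hgrowth : ∀ z : ℂ, 0 < z.re → ∃ C A r : ℝ, 0 ≤ C ∧ 0 ≤ A ∧ 0 < r ∧ ∀ s : ℂ, dist s z < r → ∀ x, ‖E₇ s x‖ ≤ C * height x ^ A := by
    intro z hz
    obtain ⟨Ca, Aa, ra, hCa, hAa, hra, ha⟩ := hag z hz
    obtain ⟨Cw, Aw, rw, hCw, hAw, hrw, hw⟩ := hWg z hz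
    refine ⟨(Fintype.card ι : ℝ) * (Ca * Cw), Aa + Aw, min ra rw, by positivity, by positivity, lt_min hra hrw, fun s hs x => ?_⟩
    have hsra : dist s z < ra := lt_of_lt_of_le hs (min_le_left _ _)
    have hsrw : dist s z < rw := lt_of_lt_of_le hs (min_le_right _ _)
    have hx := hpos x
    -- termwise bound
    have hterm : ∀ j, ‖a j s x * ((s - 1 / 2) * (Wb j s x + Wa j s x))‖ ≤ Ca * Cw * height x ^ (Aa + Aw) := by
      intro j
      calc ‖a j s x * ((s - 1 / 2) * (Wb j s x + Wa j s x))‖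
          = ‖a j s x‖ * ‖(s - 1 / 2) * (Wb j s x + Wa j s x)‖ := norm_mul _ _
        _ ≤ (Ca * height x ^ Aa) * (Cw * height x ^ Aw) :=
            mul_le_mul (ha s hsra j x) (hw s hsrw j x) (norm_nonneg _) (mul_nonneg hCa (Real.rpow_nonneg hx.le _))
        _ = Ca * Cw * (height x ^ Aa * height x ^ Aw) := by ring
        _ = Ca * Cw * height x ^ (Aa + Aw) := by rw [← Real.rpow_add hx]
    calc ‖E₇ s x‖ ≤ ∑ j, ‖a j s x * ((s - 1 / 2) * (Wb j s x + Wa j s x))‖ := norm_sum_le _ _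
      _ ≤ ∑ _j : ι, Ca * Cw * height x ^ (Aa + Aw) := Finset.sum_le_sum fun j _ => hterm j
      _ = (Fintype.card ι : ℝ) * (Ca * Cw) * height x ^ (Aa + Aw) := by
          rw [Finset.sum_const, Finset.card_univ, nsmul_eq_mul]; ring
  -- (ii) continuity, by Vitali from (i), (v) and the continuity of `RK` on the convergence half-plane
  have hcont : ∀ s : ℂ, 0 < s.re → Continuous (E₇ s) := by
    intro s hs
    refine continuous_of_differentiableOn_halfPlane (a := 0) (c := c) hc E₇ hd (fun K hK z hz => ?_) (fun s' hs' => ?_) hs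
    · obtain ⟨C, A, r, hC, hA, hr, hle⟩ := hgrowth z hz
      obtain ⟨B, hB⟩ := hcpt K hK
      refine ⟨C * max B 1 ^ A, r, hr, fun s' hs' x hx => (hle s' (mem_ball.1 hs') x).trans ?_⟩
      exact mul_le_mul_of_nonneg_left (Real.rpow_le_rpow (hpos x).le ((hB x hx).trans (le_max_left _ _)) hA) hC
    · -- on `c < re s'`, `E₇ s' = (s' − ½)·RK s'` is continuous
      have h : Continuous fun x => (∏ p ∈ ({1 / 2} : Finset ℂ), (s' - p)) * RK s' x := continuous_const.mul (hRKc s' hs')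
      exact h.congr fun x => (heq s' x hs').symm
  exact ⟨E₇, hd, hcont, heq, fun z hz => by
    obtain ⟨C, A, r, _, _, hr, hle⟩ := hgrowth z hz
    exact ⟨C, A, r, hr, hle⟩⟩

end Summit.HodgeConjecture.HodgeConjecture.Cruxes.HLiu418.K2LiuSiegelEisensteinRankOneTermPackage

end
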